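import Summits.Ventures.PercRepro.ProfileBiIndepDensity

/-!
# PercRepro — EVERY LEVEL `u` OF EVERY CO-RANK ROW `q` ON THE MINIMAL GROUND SETS `#E = u + q + 1`, FROM THE
LOG-CONCAVITY OF THE BI-INDEPENDENT DENSITY (p10, gen 9; `proofs/P10-AVFULL.md` §18(h))

On `#E = u + q + 1` (the smallest ground set on which `HardRowQ''` asks for the row `(q, u)`) every rank-`q` set `B`
with a positive demand has `#B ∈ {q, q+1}` and `ρ(E ∖ B) ∈ {u, u+1}`, every rank-`u` set `S` of co-rank `≥ q` has
`#S ∈ {u, u+1}` and `ρ(E ∖ S) ∈ {q, q+1}`; the sets of co-rank exactly `q` (resp. `u`) cancel by `X ↦ E ∖ X`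
(`card_filter_Rq_eq_card_filter_levelSetCoQ`), and what remains are the BI-INDEPENDENT `q`-sets against the
bi-independent `u`-sets:
`Π⁻_{q,u}(M) ⟺ C(u+1,q+1)·P_q ≤ C(u,q)·P_u ⟺ P_{u+1}/C(n,u+1) ≤ P_u/C(n,u)` (`P_q = P_{u+1}`,
`(u+1)·C(n,u+1) = (q+1)·C(n,u)`), the unimodality of the symmetric log-concave density at `u ≥ n/2`.

The named fact `BiIndepDensityLogConcave` (ProfileBiIndepDensity; NOT asserted) is the only hypothesis; the
top-but-one level of ProfileBiIndepDensity is the case `u = ρ(E) − 1`.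

* `sum_demand_of_card_eq_succ`, `profileIneqMinusQ_iff_of_card_eq` (the closed form on `#E = u + q + 1`);
* `filter_Rq_eq_biIndepSets_of_card`, `filter_levelSetCoQ_eq_biIndepSets_of_card`;
* **`profileIneqMinusQ_of_card_eq_succ`** (conditional on the named fact).
-/

open scoped Matroid

namespace PercRepro.Cogirth

open Finset ThmH Skew Shadow Profile

variable {α : Type} [DecidableEq α] {M : Matroid α} [M.Finite]

/-- On `#E = u + q + 1` the demand of a rank-`q` set is `C(u,q)` if its complement has rank `u`, `C(u+1,q+1)` if
its complement has rank `u + 1`, and `0` otherwise (the complement has at most `u + 1` elements). -/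
theorem sum_demand_of_card_eq_succ {q u : ℕ} (hq : q ≤ u) (hn : (gr M).card = u + q + 1) :
    ∑ B ∈ Rq M q, demand M q u B =
      u.choose q * ((Rq M q).filter (fun B => rk M (gr M \ B) = u)).card +
        (u + 1).choose (q + 1) * ((Rq M q).filter (fun B => rk M (gr M \ B) = u + 1)).card := by
  have hterm : ∀ B ∈ Rq M q, demand M q u B =
      (if rk M (gr M \ B) = u then u.choose q else 0) +
        (if rk M (gr M \ B) = u + 1 then (u + 1).choose (q + 1) else 0) := by
    intro B hB
    rw [mem_Rq] at hB
    have hrk : rk M B = q := rk_eq_of_eRk_eq hB.2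
    have h1 := rk_le_card (M := M) B
    have h2 := rk_le_card (M := M) (gr M \ B)
    have h3 := card_sdiff_of_subset hB.1
    have hle : rk M (gr M \ B) ≤ u + 1 := by omega
    unfold demand
    rcases (show rk M (gr M \ B) = u + 1 ∨ rk M (gr M \ B) = u ∨ rk M (gr M \ B) < u by omega) with h | h | h
    · rw [h, if_pos (by omega), if_neg (by omega), if_pos rfl, zero_add,
        show u - q = u + 1 - (q + 1) by omega, Nat.choose_symm (by omega)]
    · rw [h, if_pos (le_refl _), if_pos rfl, if_neg (by omega), add_zero, Nat.choose_symm hq]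
    · rw [if_neg (by omega), if_neg (by omega), if_neg (by omega)]
  rw [sum_congr rfl hterm, sum_add_distrib, ← sum_filter, ← sum_filter, sum_const, sum_const, smul_eq_mul,
    smul_eq_mul, mul_comm _ (u.choose q), mul_comm _ ((u + 1).choose (q + 1))]

/-- The closed form of the row `(q, u)` on `#E = u + q + 1`: the sets of co-rank exactly `q` / `u` cancel. -/
theorem profileIneqMinusQ_iff_of_card_eq {q u : ℕ} (hq : q ≤ u) (hn : (gr M).card = u + q + 1) :
    ProfileIneqMinusQ M q u ↔
      (u + 1).choose (q + 1) * ((Rq M q).filter (fun B => rk M (gr M \ B) = u + 1)).card ≤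
        u.choose q * ((levelSetCoQ M q u).filter (fun S => q + 1 ≤ rk M (gr M \ S))).card := by
  unfold ProfileIneqMinusQ
  rw [sum_demand_of_card_eq_succ hq hn, card_levelSetCoQ_top_but_one q u,
    ← card_filter_Rq_eq_card_filter_levelSetCoQ, Nat.mul_add]
  omega

/-- On `#E = q + r`, the rank-`q` sets whose complement has rank `r` are exactly the bi-independent `q`-sets. -/
theorem filter_Rq_eq_biIndepSets_of_card {q r : ℕ} (hn : (gr M).card = q + r) :
    (Rq M q).filter (fun B => rk M (gr M \ B) = r) = biIndepSets M q := by
  ext B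
  rw [mem_filter, mem_Rq, mem_biIndepSets]
  constructor
  · rintro ⟨⟨hBg, hBr⟩, hBc⟩
    have hrk : rk M B = q := rk_eq_of_eRk_eq hBr
    have h1 := rk_le_card (M := M) B
    have h2 := rk_le_card (M := M) (gr M \ B)
    have h3 := card_sdiff_of_subset hBg
    have h4 := card_le_card hBg
    exact ⟨hBg, by omega, by omega, by omega⟩
  · rintro ⟨hBg, hBk, hBr, hBc⟩
    have h3 := card_sdiff_of_subset hBg
    refine ⟨⟨hBg, ?_⟩, by omega⟩
    rw [← coe_rk, hBr, hBk]

/-- On `#E = u + q + 1`, the rank-`u` sets of co-rank `≥ q + 1` are exactly the bi-independent `u`-sets. -/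
theorem filter_levelSetCoQ_eq_biIndepSets_of_card {q u : ℕ} (hn : (gr M).card = u + q + 1) :
    (levelSetCoQ M q u).filter (fun S => q + 1 ≤ rk M (gr M \ S)) = biIndepSets M u := by
  ext S
  rw [mem_filter, mem_levelSetCoQ, mem_biIndepSets]
  constructor
  · rintro ⟨⟨⟨hSg, hSr⟩, _⟩, hSc⟩
    have hrk : rk M S = u := rk_eq_of_eRk_eq hSr
    have h1 := rk_le_card (M := M) S
    have h2 := rk_le_card (M := M) (gr M \ S)
    have h3 := card_sdiff_of_subset hSg
    have h4 := card_le_card hSg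
    exact ⟨hSg, by omega, by omega, by omega⟩
  · rintro ⟨hSg, hSk, hSr, hSc⟩
    have h3 := card_sdiff_of_subset hSg
    have h4 := card_le_card hSg
    refine ⟨⟨⟨hSg, ?_⟩, by omega⟩, by omega⟩
    rw [← coe_rk, hSr, hSk]

/-- **`Π⁻_{q,u}` ON THE MINIMAL GROUND SETS `#E = u + q + 1`, FOR EVERY `q < u`**, from the named fact: the row
`(q, u)` reads `C(u+1,q+1)·P_q ≤ C(u,q)·P_u`, i.e. `P_{u+1}/C(n,u+1) ≤ P_u/C(n,u)`, the monotonicity of the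
symmetric log-concave bi-independent density at `u ≥ n/2`.  The top-but-one level
(`profileIneqMinusQ_top_but_one_of_card_eq`) is the case `u = ρ(E) − 1`. -/
theorem profileIneqMinusQ_of_card_eq_succ (hfact : BiIndepDensityLogConcave α) (M : Matroid α) [M.Finite]
    {q u : ℕ} (hqu : q < u) (hn : (gr M).card = u + q + 1) : ProfileIneqMinusQ M q u := by
  rw [profileIneqMinusQ_iff_of_card_eq hqu.le hn,
    filter_Rq_eq_biIndepSets_of_card (r := u + 1) (by omega), filter_levelSetCoQ_eq_biIndepSets_of_card hn]
  obtain ⟨hlc, hniz⟩ := hfact M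
  generalize hN : (gr M).card = n at *
  set P : ℕ → ℕ := fun k => (biIndepSets M k).card with hP
  have hsymm : ∀ k, k ≤ n → P k = P (n - k) := by
    intro k hk
    simp only [hP]
    rw [← hN]
    exact card_biIndepSets_symm M (by omega)
  have hPq : P q = P (u + 1) := by rw [hsymm q (by omega)]; congr 1; omega
  have hPq1 : P (q + 1) = P u := by rw [hsymm (q + 1) (by omega)]; congr 1; omega
  let a : ℕ → ℚ := fun k => (P k : ℚ) / (n.choose k : ℚ)
  have ha : ∀ k, 0 ≤ a k := fun k => div_nonneg (Nat.cast_nonneg _) (Nat.cast_nonneg _)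
  have hchoose_pos : ∀ k, k ≤ n → (0 : ℚ) < n.choose k := fun k hk => by exact_mod_cast Nat.choose_pos hk
  have halc : ∀ k, 1 ≤ k → k + 1 ≤ n → a (k - 1) * a (k + 1) ≤ a k * a k := by
    intro k hk1 hkn
    have h := hlc k hk1 hkn
    have c1 := hchoose_pos (k - 1) (by omega)
    have c2 := hchoose_pos (k + 1) (by omega)
    have c3 := hchoose_pos k (by omega)
    simp only [a, hP]
    rw [div_mul_div_comm, div_mul_div_comm, div_le_div_iff₀ (by positivity) (by positivity)]
    have h' : ((biIndepSets M (k - 1)).card * (biIndepSets M (k + 1)).card *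
        (n.choose k * n.choose k) : ℚ) ≤
        (biIndepSets M k).card * (biIndepSets M k).card * (n.choose (k - 1) * n.choose (k + 1)) := by
      exact_mod_cast h
    nlinarith [h']
  have haniz : ∀ i k j, i < k → k < j → j ≤ n → 0 < a i → 0 < a j → 0 < a k := by
    intro i k j hik hkj hjn hi hj
    simp only [a, hP] at hi hj ⊢
    have ci := hchoose_pos i (by omega)
    have cj := hchoose_pos j (by omega)
    have ck := hchoose_pos k (by omega)
    rw [div_pos_iff_of_pos_right ci] at hi
    rw [div_pos_iff_of_pos_right cj] at hj
    rw [div_pos_iff_of_pos_right ck]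
    exact_mod_cast hniz i k j hik hkj hjn (by exact_mod_cast hi) (by exact_mod_cast hj)
  -- the pairwise inequality a_q · a_{u+1} ≤ a_{q+1} · a_u  (i = q + 1, j = u)
  have hpair := lc_pairwise (n := n) a ha halc haniz (q + 1) (by omega) u hqu (by omega)
  have hq1 : q + 1 - 1 = q := by omega
  rw [hq1] at hpair
  have hchoose_symm1 : n.choose (q + 1) = n.choose u := by
    rw [← Nat.choose_symm (by omega : q + 1 ≤ n)]; congr 1; omega
  have hchoose_symm2 : n.choose q = n.choose (u + 1) := by
    rw [← Nat.choose_symm (by omega : q ≤ n)]; congr 1; omega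
  have ha1 : a (q + 1) = a u := by simp only [a]; rw [hPq1, hchoose_symm1]
  have ha2 : a q = a (u + 1) := by simp only [a]; rw [hPq, hchoose_symm2]
  rw [ha1, ha2] at hpair
  -- a_{u+1} ≤ a_u
  have hdu : a (u + 1) ≤ a u := by nlinarith [hpair, ha (u + 1), ha u]
  -- back to ℕ: P_{u+1} · C(n,u) ≤ P_u · C(n,u+1)
  have hnat : P (u + 1) * n.choose u ≤ P u * n.choose (u + 1) := by
    have c1 := hchoose_pos (u + 1) (by omega)
    have c2 := hchoose_pos u (by omega)
    simp only [a] at hdu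
    rw [div_le_div_iff₀ c1 c2] at hdu
    exact_mod_cast hdu
  -- the binomial identities: C(n,u+1)·(u+1) = C(n,u)·(q+1) and (u+1)·C(u,q) = C(u+1,q+1)·(q+1)
  have hid1 : n.choose (u + 1) * (u + 1) = n.choose u * (q + 1) := by
    have := Nat.choose_succ_right_eq n u
    rw [this]; congr 1; omega
  have hid2 : (u + 1) * u.choose q = (u + 1).choose (q + 1) * (q + 1) := Nat.add_one_mul_choose_eq u q
  -- conclude: C(u+1,q+1) · P_q ≤ C(u,q) · P_u
  show (u + 1).choose (q + 1) * P q ≤ u.choose q * P u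
  rw [hPq]
  have hpos : 0 < (q + 1) * n.choose u := by
    have := Nat.choose_pos (show u ≤ n by omega); positivity
  refine Nat.le_of_mul_le_mul_right ?_ hpos
  calc (u + 1).choose (q + 1) * P (u + 1) * ((q + 1) * n.choose u)
      = ((u + 1).choose (q + 1) * (q + 1)) * (P (u + 1) * n.choose u) := by ring
    _ = ((u + 1) * u.choose q) * (P (u + 1) * n.choose u) := by rw [hid2]
    _ ≤ ((u + 1) * u.choose q) * (P u * n.choose (u + 1)) := Nat.mul_le_mul_left _ hnat
    _ = u.choose q * P u * (n.choose (u + 1) * (u + 1)) := by ring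
    _ = u.choose q * P u * ((q + 1) * n.choose u) := by rw [hid1]; ring

end PercRepro.Cogirth
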